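import Summits.CriticalPhenomena.PercolationContinuityZ3.Theorems.PercNearOneGluingNoHeavyLowerTailSunflowerMultiPetalDemotionKey
import Summits.CriticalPhenomena.PercolationContinuityZ3.Theorems.PercNearOneGluingNoHeavyLowerTailSunflowerMultiPetalHomeRouting
import Summits.CriticalPhenomena.PercolationContinuityZ3.Theorems.PercNearOneGluingNoHeavyLowerTailSunflowerMultiPetalSlackMonotone
import Summits.CriticalPhenomena.PercolationContinuityZ3.Theorems.PercNearOneGluingNoHeavyLowerTailSunflowerPromotion
import HarnessLib
import HarnessLib.Audit

/-!
# `NoHeavyLowerTail` (crux stmt-CriticalPhenomena-4575), abstract sunflower cubic, `k` petals: KERNEL DEMOTION never increases the partition functional `ZK`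
# NOR ANY flipped functional `ZKflip D` (all flip sets `D`, including the corner `D = M`) — Conjecture G lives on SATURATED structures

Support file (seat `prim-l12-p2` gen 32; `--supports stmt-CriticalPhenomena-4575`; companion of `…SunflowerMultiPetalDemotionKey` (this gen: pointwise keys,
`sum_powerset_flipPair`), `…SunflowerMultiPetalHomeRouting` (p359567: `ZKflip`, `FlipPartitionLemmaK`), `…SunflowerMultiPetalSlackMonotone` (p363882: `pslack_nonneg`),
`…SunflowerPromotion` (p217422: `Sunflower.sum_parts_fst_eq/snd_eq/thd_eq`) and, for `k = 3` without flips, prim-ineq-gen-2's `…SunflowerSaturation`).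
Everything here is PROVED.  Memo: run/shared/lean/prim/prim-l12/prim-l12-p2/FINDING-g32.md §3.

* `MSunflower.demote F M i₀` — KERNEL DEMOTION: a kernel set `M` with no proper kernel subset and no proper subset in a `V j`, `j ≠ i₀`, is removed from the kernel
  and from every `V j`, `j ≠ i₀` (it becomes a petal-`i₀` set; with the finest colouring `i₀` may be a fresh colour).  `lab_demote_of_ne`, `lab_demote_self`.
* **`ZKflip_demote_le`** (`D ≠ M`, i.e. `M ∆ D` nonempty): `(F.demote M i₀).ZKflip D ≤ F.ZKflip D` — each block position contributes
  `Σ_{T ⊆ Xᶜ} [s6K(⊤,·,·) − s6K(petal,·,·)] ≥ 2·pslack Xᶜ (D ∩ X) ≥ 0` (`X = M ∆ D`; key `two_kkK_le_s6K_dec_sub_petal`, `sum_powerset_flipPair`).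
* **`ZKflip_demote_le_self`** (the corner `D = M`: the partitions with two empty blocks both flip onto `M`): single-empty-block partitions pay with the REFINED key
  `kkK + twK`, the three double-empty ones contribute `2·twK ⊤ (lab Mᶜ)` each, and the good pair `(M, Mᶜ)` balances: total `≥ 3·slackTop + 6(g − [lab Mᶜ = 0]) ≥ 0`.
* **`ZK_demote_le`** (`D = ∅`; general-`k` version of `Sunflower.ZH_demote_le`).
CONSEQUENCE (with the dual move `…MultiPetalExtension` and the one-module expansion of compositions, memo §3): ★ₖ (all `k`) and Conjecture G hold iff they
hold on SATURATED structures (every minimal kernel set a union of two petal sets of different colours, every maximal bottom set an intersection of two such);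
a minimal counterexample to G is a saturated PRIME (module-free) structure.  Census (memo §4): saturated primes with a rainbow have `ZK ≥ 12` on ≤ 6 points.
-/

namespace Summit.CriticalPhenomena.PercolationContinuityZ3.Theorems.SunflowerPartition

open Finset

variable {α : Type*} [DecidableEq α]

namespace MSunflower

variable {k : ℕ} (F : MSunflower k α)

/-! ## Kernel demotion -/

/-- **KERNEL DEMOTION** of `M` towards petal `i₀`: remove `M` from the kernel and from every `V j`, `j ≠ i₀`.  Legal when no proper subset of `M` lies in the kernel
(`M` minimal, or not a kernel set at all) and no proper subset of `M` lies in a `V j` with `j ≠ i₀`. [this work] -/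
def demote (M : Finset α) (i₀ : Fin k) (hmin : ∀ T : Finset α, T ⊂ M → T ∉ F.A)
    (hlow : ∀ T : Finset α, T ⊂ M → ∀ j, j ≠ i₀ → T ∉ F.V j) : MSunflower k α where
  V j := if j = i₀ then F.V j else (F.V j).erase M
  A := F.A.erase M
  upperV := by
    intro j S T hST hS
    by_cases hj : j = i₀
    · have hS' : S ∈ F.V j := by simpa [hj] using hS
      have : T ∈ F.V j := F.upperV j hST hS'
      simpa [hj] using this
    · have hS' : S ∈ F.V j ∧ ¬ S = M := by simpa [hj] using hS
      have hSne : S ≠ M := hS'.2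
      have hSV : S ∈ F.V j := hS'.1
      have hT : T ∈ F.V j ∧ ¬ T = M := by
        refine ⟨F.upperV j hST hSV, ?_⟩
        rintro rfl
        exact hlow S (Finset.ssubset_iff_subset_ne.2 ⟨hST, hSne⟩) j hj hSV
      simpa [hj] using hT
  upperA := by
    intro S T hST hS
    have hSne : S ≠ M := (mem_erase.1 hS).1
    have hSA : S ∈ F.A := (mem_erase.1 hS).2
    refine mem_erase.2 ⟨?_, F.upperA hST hSA⟩
    rintro rfl
    exact hmin S (Finset.ssubset_iff_subset_ne.2 ⟨hST, hSne⟩) hSA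
  A_sub := by
    intro j S hS
    by_cases hj : j = i₀
    · have : S ∈ F.V j := F.A_sub j (mem_erase.1 hS).2
      simpa [hj] using this
    · have : S ∈ (F.V j).erase M := mem_erase.2 ⟨(mem_erase.1 hS).1, F.A_sub j (mem_erase.1 hS).2⟩
      simpa [hj] using this
  inter_sub := by
    intro i j hij S hS
    rw [mem_inter] at hS
    obtain ⟨hSi, hSj⟩ := hS
    have memV : ∀ {l : Fin k}, S ∈ (if l = i₀ then F.V l else (F.V l).erase M) → S ∈ F.V l := by
      intro l h
      by_cases hl : l = i₀
      · simpa [hl] using h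
      · have h' : S ∈ (F.V l).erase M := by simpa [hl] using h
        exact (mem_erase.1 h').2
    have hSne : S ≠ M := by
      -- one of `i, j` differs from `i₀`; there `S` survived the erase
      by_cases hi : i = i₀
      · have hj : j ≠ i₀ := fun h => hij (hi.trans h.symm)
        have h' : S ∈ (F.V j).erase M := by simpa [hj] using hSj
        exact (mem_erase.1 h').1
      · have h' : S ∈ (F.V i).erase M := by simpa [hi] using hSi
        exact (mem_erase.1 h').1
    exact mem_erase.2 ⟨hSne, F.inter_sub i j hij (mem_inter.2 ⟨memV hSi, memV hSj⟩)⟩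

section demote

variable (M : Finset α) (i₀ : Fin k) (hmin : ∀ T : Finset α, T ⊂ M → T ∉ F.A)
  (hlow : ∀ T : Finset α, T ⊂ M → ∀ j, j ≠ i₀ → T ∉ F.V j)

/-- Sets other than `M` keep their label under demotion. [this work] -/
theorem lab_demote_of_ne {S : Finset α} (hS : S ≠ M) : (F.demote M i₀ hmin hlow).lab S = F.lab S := by
  refine (F.lab_eq_of_mem_iff (G := F.demote M i₀ hmin hlow) ?_ ?_).symm
  · show S ∈ F.A ↔ S ∈ F.A.erase M
    rw [mem_erase]; exact ⟨fun h => ⟨hS, h⟩, fun h => h.2⟩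
  · intro j
    show S ∈ F.V j ↔ S ∈ (if j = i₀ then F.V j else (F.V j).erase M)
    by_cases hj : j = i₀
    · simp [hj]
    · simp only [hj, if_false, mem_erase]; exact ⟨fun h => ⟨hS, h⟩, fun h => h.2⟩

/-- The demoted kernel set carries the petal label `i₀` (it lies in `V i₀` because it was a kernel set). [this work] -/
theorem lab_demote_self (hM : M ∈ F.A) : (F.demote M i₀ hmin hlow).lab M = petalLab k i₀ := by
  refine (F.demote M i₀ hmin hlow).lab_eq_petalLab ?_ ?_
  · show M ∉ F.A.erase M
    simp
  · show M ∈ (if i₀ = i₀ then F.V i₀ else (F.V i₀).erase M)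
    rw [if_pos rfl]; exact F.A_sub i₀ hM

variable [Fintype α]

/-- The pointwise change of the (flipped) summand under demotion, split by WHICH block is `X := M ∆ D` (the block whose flip is `M`);
`X` nonempty guarantees that at most one block is. [this work] -/
theorem demote_summand (hM : M ∈ F.A) (D : Finset α) (hX : (symmDiff M D).Nonempty) {S T : Finset α} (hd : Disjoint S T) :
    s6K k (F.lab (symmDiff S D)) (F.lab (symmDiff T D)) (F.lab (symmDiff (S ∪ T)ᶜ D))
      - s6K k ((F.demote M i₀ hmin hlow).lab (symmDiff S D)) ((F.demote M i₀ hmin hlow).lab (symmDiff T D))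
          ((F.demote M i₀ hmin hlow).lab (symmDiff (S ∪ T)ᶜ D))
      = (if S = symmDiff M D then s6K k (Fin.last (k + 1)) (F.lab (symmDiff T D)) (F.lab (symmDiff (S ∪ T)ᶜ D))
            - s6K k (petalLab k i₀) (F.lab (symmDiff T D)) (F.lab (symmDiff (S ∪ T)ᶜ D)) else 0)
        + (if T = symmDiff M D then s6K k (F.lab (symmDiff S D)) (Fin.last (k + 1)) (F.lab (symmDiff (S ∪ T)ᶜ D))
            - s6K k (F.lab (symmDiff S D)) (petalLab k i₀) (F.lab (symmDiff (S ∪ T)ᶜ D)) else 0)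
        + (if (S ∪ T)ᶜ = symmDiff M D then s6K k (F.lab (symmDiff S D)) (F.lab (symmDiff T D)) (Fin.last (k + 1))
            - s6K k (F.lab (symmDiff S D)) (F.lab (symmDiff T D)) (petalLab k i₀) else 0) := by
  have key : ∀ B : Finset α, symmDiff B D = M ↔ B = symmDiff M D := by
    intro B; constructor
    · intro h; rw [← h, symmDiff_symmDiff_cancel_right]
    · intro h; rw [h, symmDiff_symmDiff_cancel_right]
  have hFM : F.lab M = Fin.last (k + 1) := (F.lab_eq_last_iff M).2 hM
  have hGM : (F.demote M i₀ hmin hlow).lab M = petalLab k i₀ := F.lab_demote_self M i₀ hmin hlow hM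
  have hGne : ∀ B : Finset α, B ≠ symmDiff M D → (F.demote M i₀ hmin hlow).lab (symmDiff B D) = F.lab (symmDiff B D) :=
    fun B hB => F.lab_demote_of_ne M i₀ hmin hlow (fun h => hB ((key B).1 h))
  by_cases h1 : S = symmDiff M D
  · have h2 : T ≠ symmDiff M D := Sunflower.snd_ne_of_fst_eq hX hd h1
    have h3 : (S ∪ T)ᶜ ≠ symmDiff M D := Sunflower.compl_ne_of_fst_eq hX h1
    have hS : symmDiff S D = M := (key S).2 h1
    rw [if_pos h1, if_neg h2, if_neg h3, hGne T h2, hGne (S ∪ T)ᶜ h3, hS, hFM, hGM]; ring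
  by_cases h2 : T = symmDiff M D
  · have h3 : (S ∪ T)ᶜ ≠ symmDiff M D := Sunflower.compl_ne_of_snd_eq hX h2
    have hT : symmDiff T D = M := (key T).2 h2
    rw [if_neg h1, if_pos h2, if_neg h3, hGne S h1, hGne (S ∪ T)ᶜ h3, hT, hFM, hGM]; ring
  by_cases h3 : (S ∪ T)ᶜ = symmDiff M D
  · have hU : symmDiff (S ∪ T)ᶜ D = M := (key _).2 h3
    rw [if_neg h1, if_neg h2, if_pos h3, hGne S h1, hGne T h2, hU, hFM, hGM]; ring
  · rw [if_neg h1, if_neg h2, if_neg h3, hGne S h1, hGne T h2, hGne (S ∪ T)ᶜ h3]; ring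

/-- **KERNEL DEMOTION NEVER INCREASES ANY FLIPPED FUNCTIONAL** (`X = M ∆ D` nonempty, i.e. `D ≠ M`): `(F.demote M i₀).ZKflip D ≤ F.ZKflip D`.
The three block positions each contribute `Σ_{T ⊆ Xᶜ} [s6K(⊤,·,·) − s6K(petal,·,·)] ≥ 2 · pslack Xᶜ (D ∩ X) ≥ 0`. [this work] -/
theorem ZKflip_demote_le (hM : M ∈ F.A) (D : Finset α) (hX : (symmDiff M D).Nonempty) :
    (F.demote M i₀ hmin hlow).ZKflip D ≤ F.ZKflip D := by
  rw [← sub_nonneg]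
  unfold ZKflip
  rw [← sum_sub_distrib]
  have hq : ∀ q ∈ parts α, Disjoint q.1 q.2 := fun q hq => (mem_filter.1 hq).2
  rw [sum_congr rfl fun q hqq => F.demote_summand M i₀ hmin hlow hM D hX (hq q hqq)]
  rw [sum_add_distrib, sum_add_distrib]
  set X := symmDiff M D with hXdef
  have hp0 : petalLab k i₀ ≠ 0 := petalLab_ne_zero k i₀
  have hpt : petalLab k i₀ ≠ Fin.last (k + 1) := petalLab_ne_last k i₀
  have htop : Fin.last (k + 1) = Fin.last (k + 1) ∨ Fin.last (k + 1) = 0 := Or.inl rfl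
  rw [Sunflower.sum_parts_fst_eq X (fun T R => s6K k (Fin.last (k + 1)) (F.lab (symmDiff T D)) (F.lab (symmDiff R D))
        - s6K k (petalLab k i₀) (F.lab (symmDiff T D)) (F.lab (symmDiff R D))),
    Sunflower.sum_parts_snd_eq X (fun S R => s6K k (F.lab (symmDiff S D)) (Fin.last (k + 1)) (F.lab (symmDiff R D))
        - s6K k (F.lab (symmDiff S D)) (petalLab k i₀) (F.lab (symmDiff R D))),
    Sunflower.sum_parts_thd_eq X (fun S T => s6K k (F.lab (symmDiff S D)) (F.lab (symmDiff T D)) (Fin.last (k + 1))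
        - s6K k (F.lab (symmDiff S D)) (F.lab (symmDiff T D)) (petalLab k i₀))]
  -- the offset slack of the cube `Xᶜ`
  have hsl : 0 ≤ ∑ T ∈ (Xᶜ).powerset, 2 * kkK k (F.lab (symmDiff T D)) (F.lab (symmDiff (X ∪ T)ᶜ D)) := by
    rw [← mul_sum, sum_powerset_flipPair X D (fun P Q => kkK k (F.lab P) (F.lab Q))]
    exact mul_nonneg (by norm_num) (F.pslack_nonneg Xᶜ (D ∩ X))
  have e2 : ∀ S ∈ (Xᶜ).powerset, (S ∪ X)ᶜ = (X ∪ S)ᶜ := fun S _ => by rw [union_comm]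
  have e3 : ∀ S ∈ (Xᶜ).powerset, Xᶜ \ S = (X ∪ S)ᶜ := fun S _ => by rw [compl_union, sdiff_eq_inter_compl]
  have s1 : 0 ≤ ∑ T ∈ (Xᶜ).powerset, (s6K k (Fin.last (k + 1)) (F.lab (symmDiff T D)) (F.lab (symmDiff (X ∪ T)ᶜ D))
      - s6K k (petalLab k i₀) (F.lab (symmDiff T D)) (F.lab (symmDiff (X ∪ T)ᶜ D))) :=
    le_trans hsl (sum_le_sum fun T _ => two_kkK_le_s6K_dec_sub_petal₁ htop hp0 hpt _ _)
  have s2 : 0 ≤ ∑ S ∈ (Xᶜ).powerset, (s6K k (F.lab (symmDiff S D)) (Fin.last (k + 1)) (F.lab (symmDiff (S ∪ X)ᶜ D))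
      - s6K k (F.lab (symmDiff S D)) (petalLab k i₀) (F.lab (symmDiff (S ∪ X)ᶜ D))) := by
    refine le_trans hsl (sum_le_sum fun S hS => ?_)
    rw [e2 S hS]; exact two_kkK_le_s6K_dec_sub_petal₂ htop hp0 hpt _ _
  have s3 : 0 ≤ ∑ S ∈ (Xᶜ).powerset, (s6K k (F.lab (symmDiff S D)) (F.lab (symmDiff (Xᶜ \ S) D)) (Fin.last (k + 1))
      - s6K k (F.lab (symmDiff S D)) (F.lab (symmDiff (Xᶜ \ S) D)) (petalLab k i₀)) := by
    refine le_trans hsl (sum_le_sum fun S hS => ?_)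
    rw [e3 S hS]; exact two_kkK_le_s6K_dec_sub_petal₃ htop hp0 hpt _ _
  linarith

/-- **KERNEL DEMOTION NEVER INCREASES `ZK`** (general-`k` version of the `k = 3` tree theorem `Sunflower.ZH_demote_le`). [this work] -/
theorem ZK_demote_le (hM : M ∈ F.A) (hMne : M.Nonempty) : (F.demote M i₀ hmin hlow).ZK ≤ F.ZK := by
  have h := F.ZKflip_demote_le M i₀ hmin hlow hM ∅ (by rw [show symmDiff M ∅ = M from symmDiff_bot M]; exact hMne)
  rwa [ZKflip_empty, ZKflip_empty] at h


/-! ### The corner `D = M`: two empty blocks both flip onto `M` -/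

/-- The pointwise change of the `M`-flipped summand under demotion of `M` itself, split by the pattern of EMPTY blocks (an empty block is exactly a block
flipping onto `M`; `w := lab Mᶜ`). [this work] -/
theorem demote_summand_self (hM : M ∈ F.A) (hMne : M.Nonempty) {S T : Finset α} (hd : Disjoint S T) :
    s6K k (F.lab (symmDiff S M)) (F.lab (symmDiff T M)) (F.lab (symmDiff (S ∪ T)ᶜ M))
      - s6K k ((F.demote M i₀ hmin hlow).lab (symmDiff S M)) ((F.demote M i₀ hmin hlow).lab (symmDiff T M))
          ((F.demote M i₀ hmin hlow).lab (symmDiff (S ∪ T)ᶜ M))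
      = (if S = ∅ then (if T ≠ ∅ ∧ (S ∪ T)ᶜ ≠ ∅ then
            s6K k (Fin.last (k + 1)) (F.lab (symmDiff T M)) (F.lab (symmDiff (S ∪ T)ᶜ M))
              - s6K k (petalLab k i₀) (F.lab (symmDiff T M)) (F.lab (symmDiff (S ∪ T)ᶜ M)) else 0) else 0)
        + (if T = ∅ then (if S ≠ ∅ ∧ (S ∪ T)ᶜ ≠ ∅ then
            s6K k (F.lab (symmDiff S M)) (Fin.last (k + 1)) (F.lab (symmDiff (S ∪ T)ᶜ M))
              - s6K k (F.lab (symmDiff S M)) (petalLab k i₀) (F.lab (symmDiff (S ∪ T)ᶜ M)) else 0) else 0)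
        + (if (S ∪ T)ᶜ = ∅ then (if S ≠ ∅ ∧ T ≠ ∅ then
            s6K k (F.lab (symmDiff S M)) (F.lab (symmDiff T M)) (Fin.last (k + 1))
              - s6K k (F.lab (symmDiff S M)) (F.lab (symmDiff T M)) (petalLab k i₀) else 0) else 0)
        + (if S = ∅ then (if T = ∅ then 2 * twK k (Fin.last (k + 1)) (F.lab Mᶜ) else 0) else 0)
        + (if S = ∅ then (if (S ∪ T)ᶜ = ∅ then 2 * twK k (Fin.last (k + 1)) (F.lab Mᶜ) else 0) else 0)
        + (if T = ∅ then (if (S ∪ T)ᶜ = ∅ then 2 * twK k (Fin.last (k + 1)) (F.lab Mᶜ) else 0) else 0) := by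
  set G := F.demote M i₀ hmin hlow with hG
  have hp0 : petalLab k i₀ ≠ 0 := petalLab_ne_zero k i₀
  have hpt : petalLab k i₀ ≠ Fin.last (k + 1) := petalLab_ne_last k i₀
  have htop : Fin.last (k + 1) = Fin.last (k + 1) ∨ Fin.last (k + 1) = (0 : Fin (k + 2)) := Or.inl rfl
  have hFM : F.lab M = Fin.last (k + 1) := (F.lab_eq_last_iff M).2 hM
  have hGM : G.lab M = petalLab k i₀ := F.lab_demote_self M i₀ hmin hlow hM
  have he : symmDiff (∅ : Finset α) M = M := symmDiff_eq_right.2 rfl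
  have hne : ∀ B : Finset α, B ≠ ∅ → G.lab (symmDiff B M) = F.lab (symmDiff B M) :=
    fun B hB => F.lab_demote_of_ne M i₀ hmin hlow (fun h => hB (symmDiff_eq_right.1 h))
  have huniv : (univ : Finset α) ≠ ∅ := by
    obtain ⟨x, _⟩ := hMne
    exact fun h => absurd (mem_univ x) (by rw [h]; exact notMem_empty x)
  have hw : F.lab (symmDiff univ M) = F.lab Mᶜ := by rw [symmDiff_univ_eq_compl]
  by_cases hS : S = ∅
  · subst hS
    by_cases hT : T = ∅
    · subst hT
      have hR : ((∅ : Finset α) ∪ ∅)ᶜ = univ := by simp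
      have hR' : ((∅ : Finset α) ∪ ∅)ᶜ ≠ ∅ := by rw [hR]; exact huniv
      simp only [if_true, ne_eq, not_true_eq_false, false_and, and_false, if_false, hR', zero_add, add_zero]
      rw [hR, he, hFM, hGM, hne univ huniv, hw]
      exact F.lab Mᶜ |> fun _ => s6K_dd_sub_cc₁ htop hp0 hpt _
    · by_cases hR : ((∅ : Finset α) ∪ T)ᶜ = ∅
      · have hTu : T = univ := by rwa [empty_union, Finset.compl_eq_empty_iff] at hR
        simp only [if_true, hT, hR, ne_eq, not_true_eq_false, not_false_eq_true, and_false, and_true, if_false, zero_add, add_zero]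
        rw [he, hFM, hGM, hne T hT, hTu, hw]
        exact s6K_dd_sub_cc₂ htop hp0 hpt _
      · simp only [if_true, hT, hR, ne_eq, not_false_eq_true, and_self, if_false, add_zero]
        rw [he, hFM, hGM, hne T hT, hne _ hR]
  · by_cases hT : T = ∅
    · subst hT
      by_cases hR : (S ∪ (∅ : Finset α))ᶜ = ∅
      · have hSu : S = univ := by rwa [union_empty, Finset.compl_eq_empty_iff] at hR
        simp only [hS, if_false, if_true, hR, ne_eq, not_true_eq_false, and_false, zero_add, add_zero, not_false_eq_true]
        rw [he, hFM, hGM, hne S hS, hSu, hw]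
        exact s6K_dd_sub_cc₃ htop hp0 hpt _
      · simp only [hS, if_false, if_true, hR, ne_eq, not_false_eq_true, and_self, zero_add, add_zero]
        rw [he, hFM, hGM, hne S hS, hne _ hR]
    · by_cases hR : (S ∪ T)ᶜ = ∅
      · simp only [hS, hT, hR, if_false, if_true, ne_eq, not_false_eq_true, and_self, zero_add, add_zero]
        rw [he, hFM, hGM, hne S hS, hne T hT]
      · simp only [hS, hT, hR, if_false, add_zero]
        rw [hne S hS, hne T hT, hne _ hR, sub_self]

/-- **KERNEL DEMOTION NEVER INCREASES THE `M`-FLIPPED FUNCTIONAL** (the corner `D = M` of `ZKflip_demote_le`): the single-empty-block partitions pay with the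
refined key, the three double-empty ones contribute `2·[lab Mᶜ = 0]` each, and the good pair `(M, Mᶜ)` balances the books. [this work] -/
theorem ZKflip_demote_le_self (hM : M ∈ F.A) (hMne : M.Nonempty) :
    (F.demote M i₀ hmin hlow).ZKflip M ≤ F.ZKflip M := by
  rw [← sub_nonneg]
  unfold ZKflip
  rw [← sum_sub_distrib]
  have hq : ∀ q ∈ parts α, Disjoint q.1 q.2 := fun q hq => (mem_filter.1 hq).2
  rw [sum_congr rfl fun q hqq => F.demote_summand_self M i₀ hmin hlow hM hMne (hq q hqq)]
  rw [sum_add_distrib, sum_add_distrib, sum_add_distrib, sum_add_distrib, sum_add_distrib]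
  set t : Fin (k + 2) := Fin.last (k + 1) with ht
  set c : Fin (k + 2) := petalLab k i₀ with hc
  set tw : ℤ := twK k (Fin.last (k + 1)) (F.lab Mᶜ) with htw
  have hp0 : c ≠ 0 := petalLab_ne_zero k i₀
  have hpt : c ≠ Fin.last (k + 1) := petalLab_ne_last k i₀
  have htop : t = Fin.last (k + 1) ∨ t = (0 : Fin (k + 2)) := Or.inl rfl
  have huniv : (univ : Finset α) ≠ ∅ := by
    obtain ⟨x, _⟩ := hMne
    exact fun h => absurd (mem_univ x) (by rw [h]; exact notMem_empty x)
  have he : symmDiff (∅ : Finset α) M = M := symmDiff_eq_right.2 rfl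
  have hFM : F.lab M = t := (F.lab_eq_last_iff M).2 hM
  -- the six block sums
  rw [Sunflower.sum_parts_fst_eq ∅ (fun T R => if T ≠ ∅ ∧ R ≠ ∅ then
        s6K k t (F.lab (symmDiff T M)) (F.lab (symmDiff R M)) - s6K k c (F.lab (symmDiff T M)) (F.lab (symmDiff R M)) else 0),
    Sunflower.sum_parts_snd_eq ∅ (fun S R => if S ≠ ∅ ∧ R ≠ ∅ then
        s6K k (F.lab (symmDiff S M)) t (F.lab (symmDiff R M)) - s6K k (F.lab (symmDiff S M)) c (F.lab (symmDiff R M)) else 0),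
    Sunflower.sum_parts_thd_eq ∅ (fun S T => if S ≠ ∅ ∧ T ≠ ∅ then
        s6K k (F.lab (symmDiff S M)) (F.lab (symmDiff T M)) t - s6K k (F.lab (symmDiff S M)) (F.lab (symmDiff T M)) c else 0),
    Sunflower.sum_parts_fst_eq ∅ (fun T _ => if T = ∅ then 2 * tw else 0),
    Sunflower.sum_parts_fst_eq ∅ (fun _ R => if R = ∅ then 2 * tw else 0),
    Sunflower.sum_parts_snd_eq ∅ (fun _ R => if R = ∅ then 2 * tw else 0)]
  simp only [empty_union, union_empty, compl_empty, powerset_univ]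
  -- the pair functional P(T) = kkK + twK on the flipped antipodal pair (T ∆ M, Tᶜ ∆ M)
  set P : Finset α → ℤ := fun T => kkK k (F.lab (symmDiff T M)) (F.lab (symmDiff Tᶜ M)) + twK k (F.lab (symmDiff T M)) (F.lab (symmDiff Tᶜ M)) with hP
  have hPe : P ∅ = 2 * tw := by
    simp only [hP, he, compl_empty, symmDiff_univ_eq_compl, hFM, ht]
    exact kkK_add_twK_last_left _
  have hPu : P univ = 2 * tw := by
    simp only [hP, symmDiff_univ_eq_compl, Finset.compl_univ, he, hFM, ht, htw]
    rw [kkK_add_twK_last_right]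
  have hcu : ∀ T : Finset α, Tᶜ = ∅ ↔ T = univ := fun T => Finset.compl_eq_empty_iff T
  have hus : ∀ S : Finset α, univ \ S = Sᶜ := fun S => (compl_eq_univ_sdiff S).symm
  -- (1) the three single-empty sums dominate Σ P − 4 tw each
  have key₁ : ∀ T : Finset α, P T - (if T = ∅ then 2 * tw else 0) - (if Tᶜ = ∅ then 2 * tw else 0)
      ≤ (if T ≠ ∅ ∧ Tᶜ ≠ ∅ then s6K k t (F.lab (symmDiff T M)) (F.lab (symmDiff Tᶜ M)) - s6K k c (F.lab (symmDiff T M)) (F.lab (symmDiff Tᶜ M)) else 0) := by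
    intro T
    by_cases hT : T = ∅
    · subst hT
      simp only [if_true, compl_empty, huniv, if_false, ne_eq, not_true_eq_false, false_and, sub_zero, hPe]; norm_num
    · by_cases hTc : Tᶜ = ∅
      · have hTu : T = univ := (hcu T).1 hTc
        subst hTu
        simp only [hT, if_false, hTc, if_true, ne_eq, not_true_eq_false, and_false, sub_zero, hPu]; norm_num
      · simp only [hT, hTc, if_false, ne_eq, not_false_eq_true, and_self, if_true, sub_zero]
        exact kkK_add_twK_le_s6K_dec_sub_petal₁ htop hp0 hpt _ _
  have key₂ : ∀ S : Finset α, P S - (if S = ∅ then 2 * tw else 0) - (if Sᶜ = ∅ then 2 * tw else 0)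
      ≤ (if S ≠ ∅ ∧ Sᶜ ≠ ∅ then s6K k (F.lab (symmDiff S M)) t (F.lab (symmDiff Sᶜ M)) - s6K k (F.lab (symmDiff S M)) c (F.lab (symmDiff Sᶜ M)) else 0) := by
    intro T
    by_cases hT : T = ∅
    · subst hT
      simp only [if_true, compl_empty, huniv, if_false, ne_eq, not_true_eq_false, false_and, sub_zero, hPe]; norm_num
    · by_cases hTc : Tᶜ = ∅
      · have hTu : T = univ := (hcu T).1 hTc
        subst hTu
        simp only [hT, if_false, hTc, if_true, ne_eq, not_true_eq_false, and_false, sub_zero, hPu]; norm_num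
      · simp only [hT, hTc, if_false, ne_eq, not_false_eq_true, and_self, if_true, sub_zero]
        exact kkK_add_twK_le_s6K_dec_sub_petal₂ htop hp0 hpt _ _
  have key₃ : ∀ S : Finset α, P S - (if S = ∅ then 2 * tw else 0) - (if Sᶜ = ∅ then 2 * tw else 0)
      ≤ (if S ≠ ∅ ∧ Sᶜ ≠ ∅ then s6K k (F.lab (symmDiff S M)) (F.lab (symmDiff Sᶜ M)) t - s6K k (F.lab (symmDiff S M)) (F.lab (symmDiff Sᶜ M)) c else 0) := by
    intro T
    by_cases hT : T = ∅
    · subst hT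
      simp only [if_true, compl_empty, huniv, if_false, ne_eq, not_true_eq_false, false_and, sub_zero, hPe]; norm_num
    · by_cases hTc : Tᶜ = ∅
      · have hTu : T = univ := (hcu T).1 hTc
        subst hTu
        simp only [hT, if_false, hTc, if_true, ne_eq, not_true_eq_false, and_false, sub_zero, hPu]; norm_num
      · simp only [hT, hTc, if_false, ne_eq, not_false_eq_true, and_self, if_true, sub_zero]
        exact kkK_add_twK_le_s6K_dec_sub_petal₃ htop hp0 hpt _ _
  -- (2) the indicator sums
  have hIe : ∑ T : Finset α, (if T = ∅ then 2 * tw else 0) = 2 * tw := by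
    rw [sum_ite_eq' univ (∅ : Finset α) (fun _ => 2 * tw)]; simp
  have hIu : ∑ T : Finset α, (if Tᶜ = ∅ then 2 * tw else 0) = 2 * tw := by
    have : ∀ T : Finset α, (if Tᶜ = ∅ then 2 * tw else 0) = (if T = univ then 2 * tw else 0) := fun T => by
      rw [if_congr (hcu T) rfl rfl]
    rw [sum_congr rfl fun T _ => this T, sum_ite_eq' univ (univ : Finset α) (fun _ => 2 * tw)]; simp
  -- (3) Σ P ≥ 2 tw : the kk-part is an antipodal Gladkov sum (reindexed by T ↦ T ∆ M), the tw-part contains the terms T = ∅, univ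
  have hkk : 0 ≤ ∑ T : Finset α, kkK k (F.lab (symmDiff T M)) (F.lab (symmDiff Tᶜ M)) := by
    have hg := F.antipodal_gladkov (univ : Finset α)
    rw [powerset_univ] at hg
    refine le_of_le_of_eq hg ?_
    refine sum_nbij' (fun U => symmDiff U M) (fun T => symmDiff T M) ?_ ?_ ?_ ?_ ?_
    · intro U _; exact mem_univ _
    · intro T _; exact mem_univ _
    · intro U _; exact symmDiff_symmDiff_cancel_right _ _
    · intro T _; exact symmDiff_symmDiff_cancel_right _ _
    · intro U _
      rw [symmDiff_compl_left, symmDiff_symmDiff_cancel_right, hus]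
  have htwsum : 2 * tw ≤ ∑ T : Finset α, twK k (F.lab (symmDiff T M)) (F.lab (symmDiff Tᶜ M)) := by
    have hsub : ({∅, univ} : Finset (Finset α)) ⊆ univ := subset_univ _
    have h2 := sum_le_sum_of_subset_of_nonneg hsub (fun T _ _ => twK_nonneg k (F.lab (symmDiff T M)) (F.lab (symmDiff Tᶜ M)))
    have hne : (∅ : Finset α) ≠ univ := fun h => huniv h.symm
    rw [sum_pair hne] at h2
    refine le_trans (le_of_eq ?_) h2
    rw [he, compl_empty, symmDiff_univ_eq_compl, Finset.compl_univ, he, hFM, ht, twK_last_comm, ← htw]; ring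
  have hPsum : 2 * tw ≤ ∑ T : Finset α, P T := by
    simp only [hP]
    rw [sum_add_distrib]
    linarith
  -- (4) assemble
  have s1 := sum_le_sum fun T (_ : T ∈ (univ : Finset (Finset α))) => key₁ T
  have s2 := sum_le_sum fun T (_ : T ∈ (univ : Finset (Finset α))) => key₂ T
  have s3 := sum_le_sum fun T (_ : T ∈ (univ : Finset (Finset α))) => key₃ T
  rw [sum_sub_distrib, sum_sub_distrib, hIe, hIu] at s1 s2 s3
  simp only [hus]
  linarith

end demote

end MSunflower

end Summit.CriticalPhenomena.PercolationContinuityZ3.Theorems.SunflowerPartition
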